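import Mathlib
import HarnessLib
import Summits.Ventures.LatticeQCDFlow.Exactness.SUNMetropolisORSweepFiguresOfMerit
import Summits.Ventures.LatticeQCDFlow.Exactness.CabibboMarinariORSweepFiguresOfMerit
import Summits.Ventures.LatticeQCDFlow.Exactness.SUNLeapfrogHMCORSweepFiguresOfMerit
import Summits.Ventures.LatticeQCDFlow.Scoring.BatchMeansTwoSamplerTauIntComparison
import Summits.Ventures.LatticeQCDFlow.Scoring.DoeblinPowerGeometricEnvelope

/-!
# The cell's sampler-comparison test is calibrated for the engine's certified chains (GEN-23, row 9 eng-latcore, 23-19)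

NEW WORK of the cell, not a published result; no definition is introduced; nothing is cited as a fact.
HONEST FRAMING: exact (Metropolis-corrected) sampling algorithms for lattice gauge theory; figures of merit are
autocorrelation/cost numbers at stated couplings and volumes; no continuum-physics claim.

The cell's verdict "update scheme 1 beats update scheme 2" compares COST-WEIGHTED integrated autocorrelation times
`c₁ τ_int,1` vs `c₂ τ_int,2` of one observable under two chains run independently, each analysed by batch means
(`τ̂ᵢ = σ̂²_BM,i/(2 v̂ᵢ)`), through the studentised difference
`(c₁ τ̂₁ − c₂ τ̂₂)/√(2 c₁² τ̂₁²/n + 2 c₂² τ̂₂²/m_n)`.  Row 4's `Scoring/BatchMeansTwoSamplerTauIntComparison` proves the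
NULL CALIBRATION of this test for two chains with geometric envelopes: under `c₁ τ_int,1 = c₂ τ_int,2` the probability
of `|…| ≤ z` tends to `N(0,1)([−z, z])`, from ANY pair of initial laws.

THIS FILE: §0 the same statement from two DOEBLIN CERTIFICATES `εᵢ νᵢ(B) ≤ Kᵢ^{mᵢ}(x, B)` (row 8's
`Scoring.exists_geometricEnvelope_of_nHit` supplies the envelopes) — **`twoSampler_costTauInt_coverage_of_nHit`**, for
ANY two certified kernels on any two spaces; §1 the engine instance the cell actually runs on `SU(N)`:
`'metro' + n_or × 'or'` (sampler 1) against `'hb'` (Cabibbo–Marinari) `+ n_or' × 'or'` (sampler 2) at the same `β`,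
`L ≥ 2`, both certified by GEN-23 (`SUNMetropolisORSweepFiguresOfMerit`, `CabibboMarinariORSweepFiguresOfMerit`) —
**`wilson_metroOR_vs_cmOR_costTauInt_coverage`**: whenever the two cost-weighted `τ_int` of the bounded observables
`f₁`, `f₂` are equal, "different at `z σ`" has asymptotically its nominal size, from EVERY pair of starts, for all batch
schedules as stated; §2 the other engine comparison: the DEFAULT fixed-step `'hmc'` (`nstep · ε ≤ τ₀`) followed
by ANY exact step (e.g. `n_or × 'or'`), certified by `SUNLeapfrogHMCORSweepFiguresOfMerit`, against `'hb' + n_or × 'or'`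
— **`wilson_hmc_vs_cmOR_costTauInt_coverage`**.

NOT CLAIMED: the power of the test; dependent runs; `σ²_f = 0`; any value of a cost or of a `τ_int`.
-/

noncomputable section

namespace Summit.Ventures.LatticeQCDFlow.Exactness

open MeasureTheory ProbabilityTheory ProbabilityTheory.Kernel Set Function Filter Topology
open Literature.MathematicalPhysics.QuantumFieldTheory
open Literature.MathematicalPhysics.QuantumLattice (fundamentalRep continuous_fundamentalRep)
open Summit.Ventures.LatticeQCDFlow.Scoring (replicaSEsq tauInt autocov kop)
open scoped ENNReal Matrix Matrix.Norms.Operator NNReal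

/-! ## §0 Two Doeblin certificates ⇒ the comparison test is calibrated -/

section Generic

variable {Ω₁ : Type*} [MeasurableSpace Ω₁] {Ω₂ : Type*} [MeasurableSpace Ω₂]
variable {κ₁ : Kernel Ω₁ Ω₁} [IsMarkovKernel κ₁] {π₁ : Measure Ω₁} [IsProbabilityMeasure π₁]
  {ν₁ : Measure Ω₁} [IsProbabilityMeasure ν₁] {ε₁ : ℝ≥0∞} {m₁ : ℕ}
variable {κ₂ : Kernel Ω₂ Ω₂} [IsMarkovKernel κ₂] {π₂ : Measure Ω₂} [IsProbabilityMeasure π₂]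
  {ν₂ : Measure Ω₂} [IsProbabilityMeasure ν₂] {ε₂ : ℝ≥0∞} {m₂ : ℕ}

/-- **COVERAGE OF THE COST-WEIGHTED `τ_int` COMPARISON TEST UNDER THE NULL, FROM TWO DOEBLIN CERTIFICATES.**
`κᵢ` Markov with invariant probability `πᵢ` and `εᵢ νᵢ(B) ≤ κᵢ^{mᵢ}(x, B)` (`0 < εᵢ ≤ 1`, `0 < mᵢ`); `|fᵢ| ≤ Cᵢ`
measurable with `Var_πᵢ fᵢ ≠ 0`, `σ²_f₁ > 0`; costs `c₁ > 0`, `c₂`; the null `c₁ τ_int,1 = c₂ τ_int,2`; batch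
schedules `b₁, b₂ → ∞` with `n/bᵢ(n)² → 0`, second run length index `mrun n → ∞`.  Then for every `z`, from every pair
of initial laws, `(P¹_{μ₁} ⊗ P²_{μ₂}) {|c₁ τ̂₁ − c₂ τ̂₂|/√(2c₁²τ̂₁²/n + 2c₂²τ̂₂²/m_n) ≤ z} → N(0,1)([−z, z])`. -/
theorem twoSampler_costTauInt_coverage_of_nHit
    (hπ₁ : Kernel.Invariant κ₁ π₁) (hmin₁ : ∀ x {B : Set Ω₁}, MeasurableSet B → ε₁ * ν₁ B ≤ nHit κ₁ m₁ x B)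
    (hε0₁ : 0 < ε₁) (hε1₁ : ε₁ ≤ 1) (hm₁ : 0 < m₁)
    {f₁ : Ω₁ → ℝ} (hf₁ : Measurable f₁) {C₁ : ℝ} (hC₁ : ∀ x, |f₁ x| ≤ C₁)
    (hvar₁ : autocov κ₁ π₁ (fun y => f₁ y - ∫ z, f₁ z ∂π₁) 0 ≠ 0)
    (hσ₁ : 0 < ((∫ y, (f₁ y - ∫ z, f₁ z ∂π₁) ^ 2 ∂π₁)
      + 2 * ∑' k, ∫ y, (f₁ y - ∫ z, f₁ z ∂π₁) * (kop κ₁)^[k + 1] (fun y => f₁ y - ∫ z, f₁ z ∂π₁) y ∂π₁))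
    (hπ₂ : Kernel.Invariant κ₂ π₂) (hmin₂ : ∀ x {B : Set Ω₂}, MeasurableSet B → ε₂ * ν₂ B ≤ nHit κ₂ m₂ x B)
    (hε0₂ : 0 < ε₂) (hε1₂ : ε₂ ≤ 1) (hm₂ : 0 < m₂)
    {f₂ : Ω₂ → ℝ} (hf₂ : Measurable f₂) {C₂ : ℝ} (hC₂ : ∀ x, |f₂ x| ≤ C₂)
    (hvar₂ : autocov κ₂ π₂ (fun y => f₂ y - ∫ z, f₂ z ∂π₂) 0 ≠ 0)
    {c₁ c₂ : ℝ} (hc₁ : 0 < c₁)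
    (hH0 : c₁ * tauInt (fun t => autocov κ₁ π₁ (fun y => f₁ y - ∫ z, f₁ z ∂π₁) t
          / autocov κ₁ π₁ (fun y => f₁ y - ∫ z, f₁ z ∂π₁) 0)
        = c₂ * tauInt (fun t => autocov κ₂ π₂ (fun y => f₂ y - ∫ z, f₂ z ∂π₂) t
          / autocov κ₂ π₂ (fun y => f₂ y - ∫ z, f₂ z ∂π₂) 0))
    (μ₁ : Measure Ω₁) [IsProbabilityMeasure μ₁] (μ₂ : Measure Ω₂) [IsProbabilityMeasure μ₂]
    {b₁ b₂ : ℕ → ℕ} (hb₁ : Tendsto b₁ atTop atTop) (hb₂ : Tendsto b₂ atTop atTop)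
    (hab₁ : Tendsto (fun n : ℕ => (n : ℝ) / (b₁ n : ℝ) ^ 2) atTop (𝓝 0))
    (hab₂ : Tendsto (fun n : ℕ => (n : ℝ) / (b₂ n : ℝ) ^ 2) atTop (𝓝 0))
    {mrun : ℕ → ℕ} (hm : Tendsto mrun atTop atTop)
    [IsProbabilityMeasure (Kernel.trajMeasure (X := fun _ : ℕ => Ω₁) μ₁
          (fun n : ℕ => κ₁.comap (fun h' : (i : ↥(Finset.Iic n)) → Ω₁ => h' ⟨n, Finset.mem_Iic.2 le_rfl⟩)
            (measurable_pi_apply _)))]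
    [IsProbabilityMeasure (Kernel.trajMeasure (X := fun _ : ℕ => Ω₂) μ₂
          (fun n : ℕ => κ₂.comap (fun h' : (i : ↥(Finset.Iic n)) → Ω₂ => h' ⟨n, Finset.mem_Iic.2 le_rfl⟩)
            (measurable_pi_apply _)))] (z : ℝ) :
    Tendsto (fun n : ℕ => (((Kernel.trajMeasure (X := fun _ : ℕ => Ω₁) (μ₁)
          (fun n : ℕ => (κ₁).comap (fun h' : (i : ↥(Finset.Iic n)) → Ω₁ => h' ⟨n, Finset.mem_Iic.2
                le_rfl⟩)
            (measurable_pi_apply _)))).prod ((Kernel.trajMeasure (X := fun _ : ℕ => Ω₂) (μ₂)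
          (fun n : ℕ => (κ₂).comap (fun h' : (i : ↥(Finset.Iic n)) → Ω₂ => h' ⟨n, Finset.mem_Iic.2
                le_rfl⟩)
            (measurable_pi_apply _))))).real
      {ω : (ℕ → Ω₁) × (ℕ → Ω₂) | |(c₁ * (((((b₁ n) * (n) : ℕ) : ℝ) * replicaSEsq (fun j (x : ℕ →
            Ω₁) => (∑ i ∈ Finset.range (b₁ n), f₁ (x ((b₁ n) * j + i))) / (b₁ n)) (n) ω.1) / (2 *
            ((∑ t ∈ Finset.range ((b₁ n) * (n)), f₁ (ω.1 t) ^ 2) / (((b₁ n) * (n) : ℕ) : ℝ) - ((∑ t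
            ∈ Finset.range ((b₁ n) * (n)), f₁ (ω.1 t)) / (((b₁ n) * (n) : ℕ) : ℝ)) ^ 2)))
          - c₂ * (((((b₂ (mrun n)) * (mrun n) : ℕ) : ℝ) * replicaSEsq (fun j (x : ℕ → Ω₂) => (∑ i ∈
                Finset.range (b₂ (mrun n)), f₂ (x ((b₂ (mrun n)) * j + i))) / (b₂ (mrun n))) (mrun n) ω.2) / (2
                * ((∑ t ∈ Finset.range ((b₂ (mrun n)) * (mrun n)), f₂ (ω.2 t) ^ 2) / (((b₂ (mrun n)) * (mrun n)
                : ℕ) : ℝ) - ((∑ t ∈ Finset.range ((b₂ (mrun n)) * (mrun n)), f₂ (ω.2 t)) / (((b₂ (mrun n)) *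
                (mrun n) : ℕ) : ℝ)) ^ 2))))
        / Real.sqrt (2 * (c₁ * (((((b₁ n) * (n) : ℕ) : ℝ) * replicaSEsq (fun j (x : ℕ → Ω₁) => (∑ i
              ∈ Finset.range (b₁ n), f₁ (x ((b₁ n) * j + i))) / (b₁ n)) (n) ω.1) / (2 * ((∑ t ∈
              Finset.range ((b₁ n) * (n)), f₁ (ω.1 t) ^ 2) / (((b₁ n) * (n) : ℕ) : ℝ) - ((∑ t ∈
              Finset.range ((b₁ n) * (n)), f₁ (ω.1 t)) / (((b₁ n) * (n) : ℕ) : ℝ)) ^ 2)))) ^ 2 / n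
            + 2 * (c₂ * (((((b₂ (mrun n)) * (mrun n) : ℕ) : ℝ) * replicaSEsq (fun j (x : ℕ → Ω₂) => (∑ i
                  ∈ Finset.range (b₂ (mrun n)), f₂ (x ((b₂ (mrun n)) * j + i))) / (b₂ (mrun n))) (mrun n) ω.2)
                  / (2 * ((∑ t ∈ Finset.range ((b₂ (mrun n)) * (mrun n)), f₂ (ω.2 t) ^ 2) / (((b₂ (mrun n))
                  * (mrun n) : ℕ) : ℝ) - ((∑ t ∈ Finset.range ((b₂ (mrun n)) * (mrun n)), f₂ (ω.2 t)) /
                  (((b₂ (mrun n)) * (mrun n) : ℕ) : ℝ)) ^ 2)))) ^ 2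
              / (mrun n))| ≤ z})
      atTop (𝓝 ((gaussianReal 0 1).real (Set.Icc (-z) z))) := by
  obtain ⟨A₁, ρ₁, hA₁, hρ0₁, hρ1₁, henv₁⟩ := Scoring.exists_geometricEnvelope_of_nHit hmin₁ hε0₁ hε1₁ hm₁ hπ₁
  obtain ⟨A₂, ρ₂, hA₂, hρ0₂, hρ1₂, henv₂⟩ := Scoring.exists_geometricEnvelope_of_nHit hmin₂ hε0₂ hε1₂ hm₂ hπ₂
  exact Scoring.chain_batchMeans_twoSampler_costTauInt_coverage_of_envelope hπ₁ henv₁ hA₁ hρ0₁ hρ1₁ hf₁ hC₁ hvar₁ hσ₁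
    hπ₂ henv₂ hA₂ hρ0₂ hρ1₂ hf₂ hC₂ hvar₂ hc₁ hH0 μ₁ μ₂ hb₁ hb₂ hab₁ hab₂ hm z

end Generic

/-! ## §1 The engine instance: `'metro' + n_or × 'or'` against `'hb' + n_or' × 'or'` on `SU(N)` at the same `β` -/

section MetroVsHeatBath

variable (N : ℕ) (s : ℝ) [Fact (0 < s)] [NeZero N]
variable {d L : ℕ} {m : Type*} [Fintype m] [DecidableEq m]

/-- **"IS THE HEAT BATH BETTER THAN METROPOLIS AT EQUAL COST?" IS A CALIBRATED TEST.**  Sampler 1 = `'metro'`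
(`nhit ≥ 1` SU(2)-subgroup Metropolis hits on every link) `+` the OR schedule `sched₁`; sampler 2 = the Cabibbo–Marinari
heat-bath sweep (subgroup frames in lexicographic order or its reverse, every link) `+` the OR schedule `sched₂`; both
target `π = wilsonMeasure (suRep N) β` (`L ≥ 2`).  For bounded measurable `f₁, f₂` with `Var_π fᵢ ≠ 0`, `σ²_f₁ > 0`
(sampler 1), costs `c₁ > 0`, `c₂`, under the null `c₁ τ_int,1(f₁) = c₂ τ_int,2(f₂)`, from EVERY pair of initial laws
and all batch schedules as in §0: `P(|c₁ τ̂₁ − c₂ τ̂₂|/√(2c₁²τ̂₁²/n + 2c₂²τ̂₂²/m_n) ≤ z) → N(0,1)([−z, z])`. -/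
theorem wilson_metroOR_vs_cmOR_costTauInt_coverage [NeZero L] (hL : 2 ≤ L) (β : ℝ)
    {nhit : ℕ} (hn : 1 ≤ nhit) {Ls : List (Edge d L)} (hLs : ∀ e, e ∈ Ls) (sched₁ : List (Edge d L × (Fin N ≃ Fin 2 ⊕ m)))
    [IsMarkovKernel (metropolisSweep (sunMetropolisKick N s)
                (fun U : GaugeConfig d L (Matrix.specialUnitaryGroup (Fin N) ℂ) => Real.exp (-β * wilsonAction (suRep N) U)) nhit Ls)]
    (frames : List (Fin N ≃ Fin 2 ⊕ m))
    (hlex : frames.map pairOf = lexPairs (Finset.univ.sort (· ≤ ·) : List (Fin N)) ∨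
      frames.map pairOf = (lexPairs (Finset.univ.sort (· ≤ ·) : List (Fin N))).reverse)
    {links : List (Edge d L)} (hl : ∀ e, e ∈ links) (sched₂ : List (Edge d L × (Fin N ≃ Fin 2 ⊕ m)))
    [IsMarkovKernel (latSweep (gibbsDensity fun U : GaugeConfig d L (Matrix.specialUnitaryGroup (Fin N) ℂ) => β * wilsonAction (suRep N) U) frames links)]
    {f₁ : GaugeConfig d L (Matrix.specialUnitaryGroup (Fin N) ℂ) → ℝ} (hf₁ : Measurable f₁) {C₁ : ℝ} (hC₁ : ∀ U, |f₁ U| ≤ C₁)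
    (hvar₁ : autocov (cmORSweep sched₁ ∘ₖ metropolisSweep (sunMetropolisKick N s)
                (fun U : GaugeConfig d L (Matrix.specialUnitaryGroup (Fin N) ℂ) => Real.exp (-β * wilsonAction (suRep N) U)) nhit Ls)
              (wilsonMeasure (d := d) (L := L) (suRep N) β)
              (fun y => f₁ y - ∫ z, f₁ z ∂(wilsonMeasure (d := d) (L := L) (suRep N) β)) 0 ≠ 0)
    (hσ₁ : 0 < ((∫ y, (f₁ y - ∫ z, f₁ z ∂(wilsonMeasure (d := d) (L := L) (suRep N) β)) ^ 2 ∂(wilsonMeasure (d := d) (L := L) (suRep N) β))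
      + 2 * ∑' k, ∫ y, (f₁ y - ∫ z, f₁ z ∂(wilsonMeasure (d := d) (L := L) (suRep N) β)) * (kop (cmORSweep sched₁ ∘ₖ metropolisSweep (sunMetropolisKick N s)
                (fun U : GaugeConfig d L (Matrix.specialUnitaryGroup (Fin N) ℂ) => Real.exp (-β * wilsonAction (suRep N) U)) nhit Ls))^[k + 1]
              (fun y => f₁ y - ∫ z, f₁ z ∂(wilsonMeasure (d := d) (L := L) (suRep N) β)) y ∂(wilsonMeasure (d := d) (L := L) (suRep N) β)))
    {f₂ : GaugeConfig d L (Matrix.specialUnitaryGroup (Fin N) ℂ) → ℝ} (hf₂ : Measurable f₂) {C₂ : ℝ} (hC₂ : ∀ U, |f₂ U| ≤ C₂)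
    (hvar₂ : autocov (cmORSweep sched₂ ∘ₖ
                latSweep (gibbsDensity fun U : GaugeConfig d L (Matrix.specialUnitaryGroup (Fin N) ℂ) => β * wilsonAction (suRep N) U) frames links)
              (wilsonMeasure (d := d) (L := L) (suRep N) β)
              (fun y => f₂ y - ∫ z, f₂ z ∂(wilsonMeasure (d := d) (L := L) (suRep N) β)) 0 ≠ 0)
    {c₁ c₂ : ℝ} (hc₁ : 0 < c₁)
    (hH0 : c₁ * tauInt (fun t => autocov (cmORSweep sched₁ ∘ₖ metropolisSweep (sunMetropolisKick N s)
                (fun U : GaugeConfig d L (Matrix.specialUnitaryGroup (Fin N) ℂ) => Real.exp (-β * wilsonAction (suRep N) U)) nhit Ls)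
              (wilsonMeasure (d := d) (L := L) (suRep N) β)
              (fun y => f₁ y - ∫ z, f₁ z ∂(wilsonMeasure (d := d) (L := L) (suRep N) β)) t
          / autocov (cmORSweep sched₁ ∘ₖ metropolisSweep (sunMetropolisKick N s)
                (fun U : GaugeConfig d L (Matrix.specialUnitaryGroup (Fin N) ℂ) => Real.exp (-β * wilsonAction (suRep N) U)) nhit Ls)
              (wilsonMeasure (d := d) (L := L) (suRep N) β)
              (fun y => f₁ y - ∫ z, f₁ z ∂(wilsonMeasure (d := d) (L := L) (suRep N) β)) 0)
        = c₂ * tauInt (fun t => autocov (cmORSweep sched₂ ∘ₖ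
                latSweep (gibbsDensity fun U : GaugeConfig d L (Matrix.specialUnitaryGroup (Fin N) ℂ) => β * wilsonAction (suRep N) U) frames links)
              (wilsonMeasure (d := d) (L := L) (suRep N) β)
              (fun y => f₂ y - ∫ z, f₂ z ∂(wilsonMeasure (d := d) (L := L) (suRep N) β)) t
          / autocov (cmORSweep sched₂ ∘ₖ
                latSweep (gibbsDensity fun U : GaugeConfig d L (Matrix.specialUnitaryGroup (Fin N) ℂ) => β * wilsonAction (suRep N) U) frames links)
              (wilsonMeasure (d := d) (L := L) (suRep N) β)
              (fun y => f₂ y - ∫ z, f₂ z ∂(wilsonMeasure (d := d) (L := L) (suRep N) β)) 0))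
    (μ₁ : Measure (GaugeConfig d L (Matrix.specialUnitaryGroup (Fin N) ℂ))) [IsProbabilityMeasure μ₁]
    (μ₂ : Measure (GaugeConfig d L (Matrix.specialUnitaryGroup (Fin N) ℂ))) [IsProbabilityMeasure μ₂]
    {b₁ b₂ : ℕ → ℕ} (hb₁ : Tendsto b₁ atTop atTop) (hb₂ : Tendsto b₂ atTop atTop)
    (hab₁ : Tendsto (fun n : ℕ => (n : ℝ) / (b₁ n : ℝ) ^ 2) atTop (𝓝 0))
    (hab₂ : Tendsto (fun n : ℕ => (n : ℝ) / (b₂ n : ℝ) ^ 2) atTop (𝓝 0))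
    {mrun : ℕ → ℕ} (hm : Tendsto mrun atTop atTop)
    [IsProbabilityMeasure (Kernel.trajMeasure (X := fun _ : ℕ => GaugeConfig d L (Matrix.specialUnitaryGroup (Fin N) ℂ)) μ₁
          (fun n : ℕ => (cmORSweep sched₁ ∘ₖ metropolisSweep (sunMetropolisKick N s)
                (fun U : GaugeConfig d L (Matrix.specialUnitaryGroup (Fin N) ℂ) => Real.exp (-β * wilsonAction (suRep N) U)) nhit Ls).comap
              (fun h' : (i : ↥(Finset.Iic n))
                → GaugeConfig d L (Matrix.specialUnitaryGroup (Fin N) ℂ) => h' ⟨n, Finset.mem_Iic.2 le_rfl⟩)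
            (measurable_pi_apply _)))]
    [IsProbabilityMeasure (Kernel.trajMeasure (X := fun _ : ℕ => GaugeConfig d L (Matrix.specialUnitaryGroup (Fin N) ℂ)) μ₂
          (fun n : ℕ => (cmORSweep sched₂ ∘ₖ
                latSweep (gibbsDensity fun U : GaugeConfig d L (Matrix.specialUnitaryGroup (Fin N) ℂ) => β * wilsonAction (suRep N) U) frames links).comap
              (fun h' : (i : ↥(Finset.Iic n))
                → GaugeConfig d L (Matrix.specialUnitaryGroup (Fin N) ℂ) => h' ⟨n, Finset.mem_Iic.2 le_rfl⟩)
            (measurable_pi_apply _)))] (z : ℝ) :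
    Tendsto (fun n : ℕ => (((Kernel.trajMeasure (X := fun _ : ℕ => GaugeConfig d L (Matrix.specialUnitaryGroup (Fin N) ℂ)) μ₁
          (fun n : ℕ => (cmORSweep sched₁ ∘ₖ metropolisSweep (sunMetropolisKick N s)
                (fun U : GaugeConfig d L (Matrix.specialUnitaryGroup (Fin N) ℂ) => Real.exp (-β * wilsonAction (suRep N) U)) nhit Ls).comap
              (fun h' : (i : ↥(Finset.Iic n))
                → GaugeConfig d L (Matrix.specialUnitaryGroup (Fin N) ℂ) => h' ⟨n, Finset.mem_Iic.2
                le_rfl⟩)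
            (measurable_pi_apply _)))).prod ((Kernel.trajMeasure (X := fun _ : ℕ => GaugeConfig d L (Matrix.specialUnitaryGroup (Fin N) ℂ)) μ₂
          (fun n : ℕ => (cmORSweep sched₂ ∘ₖ
                latSweep (gibbsDensity fun U : GaugeConfig d L (Matrix.specialUnitaryGroup (Fin N) ℂ) => β * wilsonAction (suRep N) U) frames links).comap
              (fun h' : (i : ↥(Finset.Iic n))
                → GaugeConfig d L (Matrix.specialUnitaryGroup (Fin N) ℂ) => h' ⟨n, Finset.mem_Iic.2
                le_rfl⟩)
            (measurable_pi_apply _))))).real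
      {ω : (ℕ → GaugeConfig d L (Matrix.specialUnitaryGroup (Fin N) ℂ)) × (ℕ → GaugeConfig d L (Matrix.specialUnitaryGroup (Fin N) ℂ)) |
          |(c₁ * (((((b₁ n) * (n) : ℕ) : ℝ) * replicaSEsq (fun j (x : ℕ →
            GaugeConfig d L (Matrix.specialUnitaryGroup (Fin N) ℂ)) => (∑ i ∈ Finset.range (b₁ n), f₁ (x ((b₁ n) * j + i))) / (b₁ n)) (n) ω.1) / (2 *
            ((∑ t ∈ Finset.range ((b₁ n) * (n)), f₁ (ω.1 t) ^ 2) / (((b₁ n) * (n) : ℕ) : ℝ) - ((∑ t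
            ∈ Finset.range ((b₁ n) * (n)), f₁ (ω.1 t)) / (((b₁ n) * (n) : ℕ) : ℝ)) ^ 2)))
          - c₂ * (((((b₂ (mrun n)) * (mrun n) : ℕ) : ℝ) * replicaSEsq (fun j (x : ℕ → GaugeConfig d L (Matrix.specialUnitaryGroup (Fin N) ℂ)) => (∑ i ∈
                Finset.range (b₂ (mrun n)), f₂ (x ((b₂ (mrun n)) * j + i))) / (b₂ (mrun n))) (mrun n) ω.2) / (2
                * ((∑ t ∈ Finset.range ((b₂ (mrun n)) * (mrun n)), f₂ (ω.2 t) ^ 2) / (((b₂ (mrun n)) * (mrun n)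
                : ℕ) : ℝ) - ((∑ t ∈ Finset.range ((b₂ (mrun n)) * (mrun n)), f₂ (ω.2 t)) / (((b₂ (mrun n)) *
                (mrun n) : ℕ) : ℝ)) ^ 2))))
        / Real.sqrt (2 * (c₁ * (((((b₁ n) * (n) : ℕ) : ℝ) * replicaSEsq (fun j (x : ℕ → GaugeConfig d L (Matrix.specialUnitaryGroup (Fin N) ℂ)) => (∑ i
              ∈ Finset.range (b₁ n), f₁ (x ((b₁ n) * j + i))) / (b₁ n)) (n) ω.1) / (2 * ((∑ t ∈
              Finset.range ((b₁ n) * (n)), f₁ (ω.1 t) ^ 2) / (((b₁ n) * (n) : ℕ) : ℝ) - ((∑ t ∈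
              Finset.range ((b₁ n) * (n)), f₁ (ω.1 t)) / (((b₁ n) * (n) : ℕ) : ℝ)) ^ 2)))) ^ 2 / n
            + 2 * (c₂ * (((((b₂ (mrun n)) * (mrun n) : ℕ) : ℝ) * replicaSEsq (fun j (x : ℕ → GaugeConfig d L (Matrix.specialUnitaryGroup (Fin N) ℂ)) => (∑ i
                  ∈ Finset.range (b₂ (mrun n)), f₂ (x ((b₂ (mrun n)) * j + i))) / (b₂ (mrun n))) (mrun n) ω.2)
                  / (2 * ((∑ t ∈ Finset.range ((b₂ (mrun n)) * (mrun n)), f₂ (ω.2 t) ^ 2) / (((b₂ (mrun n))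
                  * (mrun n) : ℕ) : ℝ) - ((∑ t ∈ Finset.range ((b₂ (mrun n)) * (mrun n)), f₂ (ω.2 t)) /
                  (((b₂ (mrun n)) * (mrun n) : ℕ) : ℝ)) ^ 2)))) ^ 2
              / (mrun n))| ≤ z})
      atTop (𝓝 ((gaussianReal 0 1).real (Set.Icc (-z) z))) := by
  haveI := isProbabilityMeasure_wilsonMeasure_suRep N (d := d) (L := L) β
  obtain ⟨hinv₁, mm, ε', hmm, hε0, hε1, hmin₁⟩ :=
    wilson_sunMetropolis_orSweep_certificate N s (d := d) hL β hn hLs sched₁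
  obtain ⟨hinv₂, ε'', hε0', hε1', hmin₂⟩ := wilson_cmSweep_orSweep_certificate N (d := d) hL β frames hlex hl sched₂
  exact twoSampler_costTauInt_coverage_of_nHit hinv₁ (GeneralNCMC.minorised_setwise hmin₁) hε0 hε1 hmm hf₁ hC₁ hvar₁ hσ₁
    hinv₂ (GeneralNCMC.minorised_setwise hmin₂) hε0' hε1' Nat.one_pos hf₂ hC₂ hvar₂ hc₁ hH0 μ₁ μ₂ hb₁ hb₂ hab₁ hab₂ hm z

end MetroVsHeatBath

/-! ## §2 The engine instance: fixed-step `'hmc'` (+ ANY exact step) against `'hb' + n_or × 'or'` on `SU(N)` -/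

section HMCVsHeatBath

variable (N : ℕ) [NeZero N] {d L : ℕ} [NeZero L] (β : ℝ)
variable {mC : Type*} [Fintype mC] [DecidableEq mC]

/-- **"IS HMC BETTER THAN THE HEAT BATH AT EQUAL COST?" IS A CALIBRATED TEST.**  There is `τ₀ > 0` (depending on
`N, d, L, β` only) such that for every `nstep ≥ 1`, `ε > 0` with `nstep · ε ≤ τ₀` and EVERY exact step `P` leaving
`π₁ = wilsonMeasure (fundamentalRep) (β/N)` invariant (sampler 1 = `P ∘ K_hmc`, e.g. `'hmc' + n_or × 'or'`), and for
sampler 2 = the Cabibbo–Marinari heat-bath sweep `+` any OR schedule at coupling `β'` (`π₂ = wilsonMeasure (suRep N) β'`,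
`L ≥ 2`): bounded measurable `f₁, f₂` with `Var fᵢ ≠ 0`, `σ²_f₁ > 0`, costs `c₁ > 0`, `c₂`, the null
`c₁ τ_int,1(f₁) = c₂ τ_int,2(f₂)` ⇒ from EVERY pair of initial laws
`P(|c₁ τ̂₁ − c₂ τ̂₂|/√(2c₁²τ̂₁²/n + 2c₂²τ̂₂²/m_n) ≤ z) → N(0,1)([−z, z])`. -/
theorem wilson_hmc_vs_cmOR_costTauInt_coverage (hL : 2 ≤ L) (β' : ℝ) (frames : List (Fin N ≃ Fin 2 ⊕ mC))
    (hlex : frames.map pairOf = lexPairs (Finset.univ.sort (· ≤ ·) : List (Fin N)) ∨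
      frames.map pairOf = (lexPairs (Finset.univ.sort (· ≤ ·) : List (Fin N))).reverse)
    {links : List (Edge d L)} (hl : ∀ e, e ∈ links) (sched : List (Edge d L × (Fin N ≃ Fin 2 ⊕ mC)))
    [IsMarkovKernel (latSweep (gibbsDensity fun U : GaugeConfig d L (Matrix.specialUnitaryGroup (Fin N) ℂ) => β' * wilsonAction (suRep N) U) frames links)] :
    ∃ τ₀ : ℝ, 0 < τ₀ ∧ ∀ (nstep : ℕ) (ε : ℝ), 1 ≤ nstep → 0 < ε → nstep * ε ≤ τ₀ →
      ∀ (P : Kernel (GaugeConfig d L (Matrix.specialUnitaryGroup (Fin N) ℂ)) (GaugeConfig d L (Matrix.specialUnitaryGroup (Fin N) ℂ)))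
        [IsMarkovKernel P], Invariant P (wilsonMeasure (d := d) (L := L) (fundamentalRep (Fin N)) (β / N)) →
      ∀ [IsMarkovKernel (sunLeapfrogHMCN (sunCoordι N) (sunCoordι_skew N) ε (Measure.addHaar : Measure (SUNCoords N))
                  (sunKinetic N) (measurable_halfKick_sun N (measurable_sunWilsonForceLaw_coeConfig N (d := d) (L := L) β) ε)
                  (fun U => β / N * wilsonAction (fundamentalRep (Fin N)) U) nstep)],
      ∀ (f₁ : GaugeConfig d L (Matrix.specialUnitaryGroup (Fin N) ℂ) → ℝ), Measurable f₁ → ∀ C₁ : ℝ, (∀ U, |f₁ U| ≤ C₁) →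
        autocov (P ∘ₖ (sunLeapfrogHMCN (sunCoordι N) (sunCoordι_skew N) ε (Measure.addHaar : Measure (SUNCoords N))
                  (sunKinetic N) (measurable_halfKick_sun N (measurable_sunWilsonForceLaw_coeConfig N (d := d) (L := L) β) ε)
                  (fun U => β / N * wilsonAction (fundamentalRep (Fin N)) U) nstep))
              (wilsonMeasure (d := d) (L := L) (fundamentalRep (Fin N)) (β / N))
              (fun y => f₁ y - ∫ z, f₁ z ∂(wilsonMeasure (d := d) (L := L) (fundamentalRep (Fin N)) (β / N))) 0 ≠ 0 →
        0 < ((∫ y, (f₁ y - ∫ z, f₁ z ∂(wilsonMeasure (d := d) (L := L) (fundamentalRep (Fin N)) (β / N))) ^ 2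
              ∂(wilsonMeasure (d := d) (L := L) (fundamentalRep (Fin N)) (β / N)))
          + 2 * ∑' k, ∫ y, (f₁ y - ∫ z, f₁ z ∂(wilsonMeasure (d := d) (L := L) (fundamentalRep (Fin N)) (β / N)))
            * (kop (P ∘ₖ (sunLeapfrogHMCN (sunCoordι N) (sunCoordι_skew N) ε (Measure.addHaar : Measure (SUNCoords N))
                  (sunKinetic N) (measurable_halfKick_sun N (measurable_sunWilsonForceLaw_coeConfig N (d := d) (L := L) β) ε)
                  (fun U => β / N * wilsonAction (fundamentalRep (Fin N)) U) nstep)))^[k + 1]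
              (fun y => f₁ y - ∫ z, f₁ z ∂(wilsonMeasure (d := d) (L := L) (fundamentalRep (Fin N)) (β / N))) y
                ∂(wilsonMeasure (d := d) (L := L) (fundamentalRep (Fin N)) (β / N))) →
      ∀ (f₂ : GaugeConfig d L (Matrix.specialUnitaryGroup (Fin N) ℂ) → ℝ), Measurable f₂ → ∀ C₂ : ℝ, (∀ U, |f₂ U| ≤ C₂) →
        autocov (cmORSweep sched ∘ₖ
                latSweep (gibbsDensity fun U : GaugeConfig d L (Matrix.specialUnitaryGroup (Fin N) ℂ) => β' * wilsonAction (suRep N) U) frames links)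
              (wilsonMeasure (d := d) (L := L) (suRep N) β')
              (fun y => f₂ y - ∫ z, f₂ z ∂(wilsonMeasure (d := d) (L := L) (suRep N) β')) 0 ≠ 0 →
      ∀ (c₁ c₂ : ℝ), 0 < c₁ →
        c₁ * tauInt (fun t => autocov (P ∘ₖ (sunLeapfrogHMCN (sunCoordι N) (sunCoordι_skew N) ε (Measure.addHaar : Measure (SUNCoords N))
                  (sunKinetic N) (measurable_halfKick_sun N (measurable_sunWilsonForceLaw_coeConfig N (d := d) (L := L) β) ε)
                  (fun U => β / N * wilsonAction (fundamentalRep (Fin N)) U) nstep))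
              (wilsonMeasure (d := d) (L := L) (fundamentalRep (Fin N)) (β / N))
              (fun y => f₁ y - ∫ z, f₁ z ∂(wilsonMeasure (d := d) (L := L) (fundamentalRep (Fin N)) (β / N))) t
            / autocov (P ∘ₖ (sunLeapfrogHMCN (sunCoordι N) (sunCoordι_skew N) ε (Measure.addHaar : Measure (SUNCoords N))
                  (sunKinetic N) (measurable_halfKick_sun N (measurable_sunWilsonForceLaw_coeConfig N (d := d) (L := L) β) ε)
                  (fun U => β / N * wilsonAction (fundamentalRep (Fin N)) U) nstep))
              (wilsonMeasure (d := d) (L := L) (fundamentalRep (Fin N)) (β / N))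
              (fun y => f₁ y - ∫ z, f₁ z ∂(wilsonMeasure (d := d) (L := L) (fundamentalRep (Fin N)) (β / N))) 0)
          = c₂ * tauInt (fun t => autocov (cmORSweep sched ∘ₖ
                latSweep (gibbsDensity fun U : GaugeConfig d L (Matrix.specialUnitaryGroup (Fin N) ℂ) => β' * wilsonAction (suRep N) U) frames links)
              (wilsonMeasure (d := d) (L := L) (suRep N) β')
              (fun y => f₂ y - ∫ z, f₂ z ∂(wilsonMeasure (d := d) (L := L) (suRep N) β')) t
            / autocov (cmORSweep sched ∘ₖ
                latSweep (gibbsDensity fun U : GaugeConfig d L (Matrix.specialUnitaryGroup (Fin N) ℂ) => β' * wilsonAction (suRep N) U) frames links)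
              (wilsonMeasure (d := d) (L := L) (suRep N) β')
              (fun y => f₂ y - ∫ z, f₂ z ∂(wilsonMeasure (d := d) (L := L) (suRep N) β')) 0) →
      ∀ (μ₁ : Measure (GaugeConfig d L (Matrix.specialUnitaryGroup (Fin N) ℂ))) [IsProbabilityMeasure μ₁]
        (μ₂ : Measure (GaugeConfig d L (Matrix.specialUnitaryGroup (Fin N) ℂ))) [IsProbabilityMeasure μ₂]
        (b₁ b₂ : ℕ → ℕ), Tendsto b₁ atTop atTop → Tendsto b₂ atTop atTop →
        Tendsto (fun n : ℕ => (n : ℝ) / (b₁ n : ℝ) ^ 2) atTop (𝓝 0) →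
        Tendsto (fun n : ℕ => (n : ℝ) / (b₂ n : ℝ) ^ 2) atTop (𝓝 0) →
      ∀ (mrun : ℕ → ℕ), Tendsto mrun atTop atTop →
      ∀ [IsProbabilityMeasure (Kernel.trajMeasure (X := fun _ : ℕ => GaugeConfig d L (Matrix.specialUnitaryGroup (Fin N) ℂ)) μ₁
          (fun n : ℕ => (P ∘ₖ (sunLeapfrogHMCN (sunCoordι N) (sunCoordι_skew N) ε (Measure.addHaar : Measure (SUNCoords N))
                  (sunKinetic N) (measurable_halfKick_sun N (measurable_sunWilsonForceLaw_coeConfig N (d := d) (L := L) β) ε)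
                  (fun U => β / N * wilsonAction (fundamentalRep (Fin N)) U) nstep)).comap
              (fun h' : (i : ↥(Finset.Iic n))
                → GaugeConfig d L (Matrix.specialUnitaryGroup (Fin N) ℂ) => h' ⟨n, Finset.mem_Iic.2 le_rfl⟩)
            (measurable_pi_apply _)))]
        [IsProbabilityMeasure (Kernel.trajMeasure (X := fun _ : ℕ => GaugeConfig d L (Matrix.specialUnitaryGroup (Fin N) ℂ)) μ₂
          (fun n : ℕ => (cmORSweep sched ∘ₖ
                latSweep (gibbsDensity fun U : GaugeConfig d L (Matrix.specialUnitaryGroup (Fin N) ℂ) => β' * wilsonAction (suRep N) U) frames links).comap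
              (fun h' : (i : ↥(Finset.Iic n))
                → GaugeConfig d L (Matrix.specialUnitaryGroup (Fin N) ℂ) => h' ⟨n, Finset.mem_Iic.2 le_rfl⟩)
            (measurable_pi_apply _)))] (z : ℝ),
        Tendsto (fun n : ℕ => (((Kernel.trajMeasure (X := fun _ : ℕ => GaugeConfig d L (Matrix.specialUnitaryGroup (Fin N) ℂ)) μ₁
              (fun n : ℕ => (P ∘ₖ (sunLeapfrogHMCN (sunCoordι N) (sunCoordι_skew N) ε (Measure.addHaar : Measure (SUNCoords N))
                      (sunKinetic N) (measurable_halfKick_sun N (measurable_sunWilsonForceLaw_coeConfig N (d := d) (L := L) β) ε)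
                      (fun U => β / N * wilsonAction (fundamentalRep (Fin N)) U) nstep)).comap
              (fun h' : (i : ↥(Finset.Iic n))
                → GaugeConfig d L (Matrix.specialUnitaryGroup (Fin N) ℂ) => h' ⟨n, Finset.mem_Iic.2
                    le_rfl⟩)
                (measurable_pi_apply _)))).prod ((Kernel.trajMeasure (X := fun _ : ℕ => GaugeConfig d L (Matrix.specialUnitaryGroup (Fin N) ℂ)) μ₂
              (fun n : ℕ => (cmORSweep sched ∘ₖ
                    latSweep (gibbsDensity fun U : GaugeConfig d L (Matrix.specialUnitaryGroup (Fin N) ℂ) => β' * wilsonAction (suRep N) U) frames links).comap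
              (fun h' : (i : ↥(Finset.Iic n))
                → GaugeConfig d L (Matrix.specialUnitaryGroup (Fin N) ℂ) => h' ⟨n, Finset.mem_Iic.2
                    le_rfl⟩)
                (measurable_pi_apply _))))).real
          {ω : (ℕ → GaugeConfig d L (Matrix.specialUnitaryGroup (Fin N) ℂ)) × (ℕ → GaugeConfig d L (Matrix.specialUnitaryGroup (Fin N) ℂ)) |
          |(c₁ * (((((b₁ n) * (n) : ℕ) : ℝ) * replicaSEsq (fun j (x : ℕ →
                GaugeConfig d L (Matrix.specialUnitaryGroup (Fin N) ℂ)) => (∑ i ∈ Finset.range (b₁ n), f₁ (x ((b₁ n) * j + i))) / (b₁ n)) (n) ω.1) / (2 *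
                ((∑ t ∈ Finset.range ((b₁ n) * (n)), f₁ (ω.1 t) ^ 2) / (((b₁ n) * (n) : ℕ) : ℝ) - ((∑ t
                ∈ Finset.range ((b₁ n) * (n)), f₁ (ω.1 t)) / (((b₁ n) * (n) : ℕ) : ℝ)) ^ 2)))
              - c₂ * (((((b₂ (mrun n)) * (mrun n) : ℕ) : ℝ) * replicaSEsq (fun j (x : ℕ → GaugeConfig d L (Matrix.specialUnitaryGroup (Fin N) ℂ)) => (∑ i ∈
                    Finset.range (b₂ (mrun n)), f₂ (x ((b₂ (mrun n)) * j + i))) / (b₂ (mrun n))) (mrun n) ω.2) / (2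
                    * ((∑ t ∈ Finset.range ((b₂ (mrun n)) * (mrun n)), f₂ (ω.2 t) ^ 2) / (((b₂ (mrun n)) * (mrun n)
                    : ℕ) : ℝ) - ((∑ t ∈ Finset.range ((b₂ (mrun n)) * (mrun n)), f₂ (ω.2 t)) / (((b₂ (mrun n)) *
                    (mrun n) : ℕ) : ℝ)) ^ 2))))
            / Real.sqrt (2 * (c₁ * (((((b₁ n) * (n) : ℕ) : ℝ) * replicaSEsq (fun j (x : ℕ → GaugeConfig d L (Matrix.specialUnitaryGroup (Fin N) ℂ)) => (∑ i
                  ∈ Finset.range (b₁ n), f₁ (x ((b₁ n) * j + i))) / (b₁ n)) (n) ω.1) / (2 * ((∑ t ∈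
                  Finset.range ((b₁ n) * (n)), f₁ (ω.1 t) ^ 2) / (((b₁ n) * (n) : ℕ) : ℝ) - ((∑ t ∈
                  Finset.range ((b₁ n) * (n)), f₁ (ω.1 t)) / (((b₁ n) * (n) : ℕ) : ℝ)) ^ 2)))) ^ 2 / n
                + 2 * (c₂ * (((((b₂ (mrun n)) * (mrun n) : ℕ) : ℝ) * replicaSEsq (fun j (x : ℕ → GaugeConfig d L (Matrix.specialUnitaryGroup (Fin N) ℂ)) => (∑ i
                      ∈ Finset.range (b₂ (mrun n)), f₂ (x ((b₂ (mrun n)) * j + i))) / (b₂ (mrun n))) (mrun n) ω.2)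
                      / (2 * ((∑ t ∈ Finset.range ((b₂ (mrun n)) * (mrun n)), f₂ (ω.2 t) ^ 2) / (((b₂ (mrun n))
                      * (mrun n) : ℕ) : ℝ) - ((∑ t ∈ Finset.range ((b₂ (mrun n)) * (mrun n)), f₂ (ω.2 t)) /
                      (((b₂ (mrun n)) * (mrun n) : ℕ) : ℝ)) ^ 2)))) ^ 2
                  / (mrun n))| ≤ z})
          atTop (𝓝 ((gaussianReal 0 1).real (Set.Icc (-z) z))) := by
  haveI : IsProbabilityMeasure (wilsonMeasure (d := d) (L := L) (suRep N) β') :=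
    isProbabilityMeasure_wilsonMeasure _ continuous_suRep β'
  obtain ⟨τ₀, hτ₀, h⟩ := wilson_sunLeapfrogHMCN_exactStep_certificate N (d := d) (L := L) β
  refine ⟨τ₀, hτ₀, fun nstep ε hn hε hτ P _ hP _ f₁ hf₁ C₁ hC₁ hvar₁ hσ₁ f₂ hf₂ C₂ hC₂ hvar₂ c₁ c₂ hc₁ hH0
    μ₁ _ μ₂ _ b₁ b₂ hb₁ hb₂ hab₁ hab₂ mrun hm _ _ z => ?_⟩
  obtain ⟨hinv₁, m₁, ε₁, hm₁, hε0, hε1, hmin₁⟩ := h nstep ε hn hε hτ P hP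
  obtain ⟨hinv₂, ε'', hε0', hε1', hmin₂⟩ := wilson_cmSweep_orSweep_certificate N (d := d) hL β' frames hlex hl sched
  exact twoSampler_costTauInt_coverage_of_nHit hinv₁ (GeneralNCMC.minorised_setwise hmin₁) hε0 hε1 hm₁ hf₁ hC₁ hvar₁ hσ₁
    hinv₂ (GeneralNCMC.minorised_setwise hmin₂) hε0' hε1' Nat.one_pos hf₂ hC₂ hvar₂ hc₁ hH0 μ₁ μ₂ hb₁ hb₂ hab₁ hab₂ hm z

end HMCVsHeatBath

end Summit.Ventures.LatticeQCDFlow.Exactness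

end
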